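import Summits.AtomisticToContinuum.HydrodynamicLimit.Theorems.RelayRaceLocalityNearConstantShortTimeHLBallGaussianEstimate
import Summits.AtomisticToContinuum.HydrodynamicLimit.Theorems.RelayRaceLocalityNearConstantShortTimeHLSt2SplitDefs
import HarnessLib

/-!
# Crux `NearConstantShortTimeHL` (stmt-AtomisticToContinuum-12502), line `small-tilt-domination` — registered skeleton stub
`stub_ballGaussianEstimate : BallGaussianEstimate`

The named statement `BallGaussianEstimate` (`…St2SplitDefs`) is, verbatim, the proposition proved by the landed theorem
`ball_gaussian_estimate` (`…BallGaussianEstimate`); this file records the registered stub of skeleton v10 of the line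
`small-tilt-domination` by that identification.

References: H.-T. Yau, Lett. Math. Phys. 22 (1991) §2.
-/

noncomputable section

namespace Summit.AtomisticToContinuum.HydrodynamicLimit.Theorems.NearConstantShortTimeHL

/-- **Registered skeleton stub `stub_ballGaussianEstimate`** (St2′-B of skeleton v10): the ball Gaussian estimate holds —
it is the landed `ball_gaussian_estimate`, whose statement is the body of `BallGaussianEstimate`. [cite: Yau1991, §2] -/
theorem stub_ballGaussianEstimate : BallGaussianEstimate :=
  ball_gaussian_estimate

end Summit.AtomisticToContinuum.HydrodynamicLimit.Theorems.NearConstantShortTimeHL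

end
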